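/-
Copyright: the b2b-balaban T⁴-continuum CRUX team, row NE7b, leaf prover `t4-ne7b-formalise-leaf-01` (gen 79), for the
OWNER lineage `t4-ne7b-p1` (gen 105's memo `A1C-LCS-RESIDUAL-g105.md` §2, residual (R2)) and the refuter desk. Project licence.
-/
import Summits.QuantumFields.BalabanUV.T4Continuum.Spine.NE7b.AndersonGaussianComparison
import Summits.QuantumFields.BalabanUV.T4Continuum.Spine.NE7b.GaussianRestrictedMoment

/-!
# THE DOMINATION LEMMA SURVIVES AN EVEN LOG-CONCAVE NON-GAUSSIAN FACTOR — AT THE SAME CONSTANT (CENTRED MODEL): symmetric convex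
# small-field restrictions and the even convex part of the non-Gaussian remainder cost NOTHING in «LCS-j» (row NE7b, node U5c; first
# kernel object for the (R2) residual, model level)

Cell `pub-balaban`, sub-cell `t4`, spine estimate NE7b (`T4WeightBudget.RelWeightBound` — the cell's OWN estimate, NOT PRINTED in
[Bałaban 1983–89], NOT PROVED).  Crux-route MODEL work under `Spine/NE7b/` in the OWNER's currency (`GaussianDominatedMoment`,
`GaussianRestrictedMoment`); it types NO `T4Continuum/Support` leaf, mints no `Prop`, names no object of [B15]∕[B16]; 0 `sorry`.

WHY.  The OWNER's memo `A1C-LCS-RESIDUAL-g105.md` §2 names, after the Gaussian share, the residual **(R2) = the NON-GAUSSIAN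
small-field remainder**: the pinned step's fluctuation density is `χ·e^{−S_y(z)−V_y(z)}` and its carrier ratio
`∫ e^{Q} χ e^{−S−V} ∕ ∫ χ e^{−S−V}` must be `≤ e^{b_G + b_V}`, `b_V = O(#Z̃)·sup|local terms of V|` up to a cluster-expansion
decoupling — «NO kernel object today; programme-sized».  THIS FILE is a first kernel object on (R2): for the class of non-Gaussian
factors `F = χ·e^{−V}` that are EVEN and (midpoint-)LOG-CONCAVE — (a) the indicator `χ` of ANY symmetric convex small-field domain,
in particular `{z : zᵀQ_b z ≤ θ_b ∀ b ∈ B}` for positive-semidefinite `Q_b` (`indicator_qfBall_evenLogConcave`); (b) `e^{−V}` for the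
EVEN CONVEX part `V` of a non-quadratic remainder (`exp_neg_evenLogConcave`); (c) products (`mul_evenLogConcave`) — the OWNER's
domination lemma holds in `F`'s OWN normalisation WITH THE SAME CONSTANT:
  **`∫ F·e^{xᵀQx}·e^{−xᵀSx} ≤ (√(1−δ))⁻¹ ^ r · ∫ F·e^{−xᵀSx}`**   (`logConcaveMoment_le`),
i.e. `b_V = 0` for this class: NO `(1−η)⁻¹` device (compare `GaussianRestrictedMoment.restrictedMoment_le`, which needs the
large-field mass hypothesis `∫(1−F)e^{−S} ≤ η∫e^{−S}`, `η < 1`, and pays `(1−η)⁻¹` — the refuter's κ-ne7bref-g65-1 «volume-safe only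
with a LOCAL F»; here `F` may be as GLOBAL and as EXTENSIVE as one likes), NO decoupling error, rank-local, volume-free, coupling-free.
MECHANISM: `e^{xᵀQx}e^{−xᵀSx}` is a WIDER centred Gaussian than `e^{−xᵀSx}`, and a wider centred Gaussian gives LESS weight to an even
log-concave function — T. W. Anderson 1955 in the functional form of the companion `AndersonGaussianComparison.lintegral_mul_wide_le`
(Prékopa–Leindler + Gaussian mixture), after the OWNER's simultaneous diagonalisation `QuadFormSimDiag.exists_simDiag_dominated`.

WHAT IS PROVED ([folklore] over the OWNER's kernel files and the companion):
* §1 the class: `le_zero_of_evenLogConcave` (`F ≤ F 0`), `exp_neg_evenLogConcave`, `indicator_evenLogConcave`, `qf_midpoint_le`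
  (sublevel sets of a PSD form are midpoint-convex), `indicator_qfBall_evenLogConcave`, `mul_evenLogConcave`.
* §2 **`integral_mul_wide_mul_le`** — the four-integral comparison `(∫ F e^{Q}e^{−S})(∫ e^{−S}) ≤ (∫ F e^{−S})(∫ e^{Q}e^{−S})` for `S` PD,
  `Q` PSD, `Q ≤ δS`, `δ < 1`, `F ≥ 0` measurable even midpoint-log-concave (change of variables to the companion's product form).
* §3 **`logConcaveMoment_le`** (displayed), `logConcaveMoment_div_le` (normalised, unconditional), `logConcaveTail_le` (Chernoff: the
  large-field tail `∫ F·𝟙{θ ≤ xᵀQx}·e^{−S} ≤ e^{−θ}(√(1−δ))⁻¹ ^ r ∫ F e^{−S}` in `F`'s normalisation), `logConcaveMoment_le_smul`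
  (coupling-free), **`logConcaveCarrier_le`** (the background-uniform carrier bound `0 ≤ M y ≤ e^{r·(−log(1−δ)∕2)}` — the input of
  `GaussianDominatedMoment.locCondStability_of_carrier_le` ∕ `CarrierOnSupport…`, exactly as the OWNER's `gaussianCarrier_le` but for the
  non-Gaussian kernels `F_y·e^{−S_y}`), and `symmConvexRestrictedMoment_le` (the small-field restriction to `{zᵀQ_b z ≤ θ_b ∀ b}` at NO cost).

NOT HERE (honest).  Bałaban's `V_y` ([B15] (0.3)–(0.5)) is NOT even-convex: its cubic ∕ background-dependent part is where print's
cluster ∕ random-walk expansion is needed — (R2) PROPER for that part, (R1″) and the identification (A3) are UNMOVED; this file only shows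
that the (R2) obstruction is CONFINED to the odd ∕ non-convex part of the remainder and that symmetric convex `χ` never cost anything.
CENTRING (refuter κ-ne7bref-g67-4 (a)): everything here is CENTRED — the Gaussian `e^{−xᵀSx}`, the sacrificed form and `F` are all even
about `0`; in the fibrewise frame over a far field the near fibre Gaussian is centred at the induced mean `−m(x₂)` while `F` stays centred
at `0`, so the class is zero-cost MODULO (R1″) (verbatim only at zero far field ∕ in the block-decoupled model); and print's small-field
windows are sublevel sets of NONLINEAR plaquette functionals — symmetric convex only in the `qfBall` idealisation (κ-ne7bref-g67-4 (b)).
BY-NAME EFFECT ON THE WALL: NONE.  NE7b NOT PRINTED ∕ NOT PROVED; spine PROVED 0∕9; rung (B)+1 on a FINITE torus — NOT infinite volume,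
NOT the mass gap, NOT Clay.
HONEST DEPENDENCY: continuum YM on T⁴ ⇐ BetaPertH ∧ nine spine estimates (0/9 proved); BetaPertH ⇐ (D1) ∧ (D4) ∧ CAP+tail;
G-an2-4 gates asym, D1 and NE2/3/4.
-/

set_option autoImplicit false

open MeasureTheory Real Matrix Finset
open scoped ENNReal
open Summit.QuantumFields.BalabanUV.T4Continuum.NE7b.QuadFormSimDiag
open Summit.QuantumFields.BalabanUV.T4Continuum.NE7b.GaussianDominatedMoment
open Summit.QuantumFields.BalabanUV.T4Continuum.NE7b.GaussianRestrictedMoment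
open Summit.QuantumFields.BalabanUV.T4Continuum.NE7b.AndersonGaussianComparison

namespace Summit.QuantumFields.BalabanUV.T4Continuum.NE7b.LogConcaveDominatedMoment

variable {n : Type*} [Fintype n] [DecidableEq n]

/-! ## §1 The class of even, midpoint-log-concave factors and its suppliers -/

omit [Fintype n] [DecidableEq n] in
/-- An even midpoint-log-concave `F ≥ 0` is maximal at the origin: `F x ≤ F 0` (so `F` is bounded). [folklore] -/
theorem le_zero_of_evenLogConcave {F : (n → ℝ) → ℝ} (hF0 : ∀ x, 0 ≤ F x) (hFe : ∀ x, F (-x) = F x)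
    (hFlc : ∀ x y, F x * F y ≤ F ((2 : ℝ)⁻¹ • (x + y)) ^ 2) (x : n → ℝ) : F x ≤ F 0 := by
  have h := hFlc x (-x)
  rw [add_neg_cancel, smul_zero, hFe, ← pow_two] at h
  exact (pow_le_pow_iff_left₀ (hF0 x) (hF0 0) two_ne_zero).1 h

omit [Fintype n] [DecidableEq n] in
/-- **SUPPLIER (b): the even convex part of a remainder.**  For `V` convex and even, `F = e^{−V}` is nonnegative, even and
midpoint-log-concave. [folklore] -/
theorem exp_neg_evenLogConcave {V : (n → ℝ) → ℝ} (hVc : ConvexOn ℝ Set.univ V) (hVe : ∀ x, V (-x) = V x) :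
    (∀ x, 0 ≤ exp (-V x)) ∧ (∀ x, exp (-V (-x)) = exp (-V x)) ∧
      ∀ x y, exp (-V x) * exp (-V y) ≤ exp (-V ((2 : ℝ)⁻¹ • (x + y))) ^ 2 := by
  refine ⟨fun x => (exp_pos _).le, fun x => by rw [hVe], fun x y => ?_⟩
  rw [← exp_add, ← exp_nat_mul, exp_le_exp]
  have h := hVc.2 (Set.mem_univ x) (Set.mem_univ y) (by norm_num : (0 : ℝ) ≤ 2⁻¹) (by norm_num : (0 : ℝ) ≤ 2⁻¹)
    (by norm_num)
  rw [← smul_add, smul_eq_mul, smul_eq_mul] at h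
  push_cast
  linarith

omit [Fintype n] [DecidableEq n] in
/-- **SUPPLIER (a): a symmetric midpoint-convex domain.**  The indicator of a set closed under `x ↦ −x` and under midpoints is
nonnegative, even and midpoint-log-concave. [folklore] -/
theorem indicator_evenLogConcave {K : Set (n → ℝ)} (hKs : ∀ x ∈ K, -x ∈ K)
    (hKm : ∀ x ∈ K, ∀ y ∈ K, (2 : ℝ)⁻¹ • (x + y) ∈ K) :
    (∀ x, 0 ≤ K.indicator (fun _ => (1 : ℝ)) x) ∧
      (∀ x, K.indicator (fun _ => (1 : ℝ)) (-x) = K.indicator (fun _ => (1 : ℝ)) x) ∧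
      ∀ x y, K.indicator (fun _ => (1 : ℝ)) x * K.indicator (fun _ => (1 : ℝ)) y ≤
        K.indicator (fun _ => (1 : ℝ)) ((2 : ℝ)⁻¹ • (x + y)) ^ 2 := by
  refine ⟨fun x => Set.indicator_nonneg (fun _ _ => zero_le_one) x, fun x => ?_, fun x y => ?_⟩
  · by_cases hx : x ∈ K
    · rw [Set.indicator_of_mem hx, Set.indicator_of_mem (by simpa using hKs x hx)]
    · have hnx : -x ∉ K := fun h => hx (by simpa using hKs _ h)
      rw [Set.indicator_of_notMem hx, Set.indicator_of_notMem hnx]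
  · by_cases hx : x ∈ K
    · by_cases hy : y ∈ K
      · rw [Set.indicator_of_mem hx, Set.indicator_of_mem hy, Set.indicator_of_mem (hKm x hx y hy)]
        norm_num
      · rw [Set.indicator_of_notMem hy, mul_zero]
        exact sq_nonneg _
    · rw [Set.indicator_of_notMem hx, zero_mul]
      exact sq_nonneg _

omit [DecidableEq n] in
/-- The sublevel sets of a positive-semidefinite quadratic form are midpoint-convex: `mᵀQm ≤ (xᵀQx + yᵀQy)∕2` for `m = (x+y)∕2`
(parallelogram identity + `(x−y)ᵀQ(x−y) ≥ 0`). [folklore] -/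
theorem qf_midpoint_le {Q : Matrix n n ℝ} (hQ : Q.PosSemidef) (x y : n → ℝ) :
    ((2 : ℝ)⁻¹ • (x + y)) ⬝ᵥ (Q *ᵥ ((2 : ℝ)⁻¹ • (x + y))) ≤ 2⁻¹ * (x ⬝ᵥ (Q *ᵥ x) + y ⬝ᵥ (Q *ᵥ y)) := by
  have hpar : (x + y) ⬝ᵥ (Q *ᵥ (x + y)) + (x - y) ⬝ᵥ (Q *ᵥ (x - y)) = 2 * (x ⬝ᵥ (Q *ᵥ x)) + 2 * (y ⬝ᵥ (Q *ᵥ y)) := by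
    simp only [mulVec_add, mulVec_sub, dotProduct_add, dotProduct_sub, add_dotProduct, sub_dotProduct]
    ring
  have hpos := qf_nonneg_of_posSemidef hQ (x - y)
  rw [mulVec_smul, dotProduct_smul, smul_dotProduct, smul_eq_mul, smul_eq_mul]
  nlinarith

omit [DecidableEq n] in
/-- **SUPPLIER (a′): the small-field domain of finitely many quadratic conditions.**  For positive-semidefinite `Q_b` the symmetric
convex set `K = {x | xᵀQ_b x ≤ θ_b ∀ b ∈ B}` (complement of the OWNER's large-field events `{θ_b ≤ xᵀQ_b x}` up to the boundary) has an
indicator that is measurable, nonnegative, even and midpoint-log-concave. [folklore] -/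
theorem indicator_qfBall_evenLogConcave {ι : Type*} (B : Finset ι) (Qb : ι → Matrix n n ℝ) (θ : ι → ℝ)
    (hQ : ∀ b ∈ B, (Qb b).PosSemidef) :
    Measurable ({x : n → ℝ | ∀ b ∈ B, x ⬝ᵥ (Qb b *ᵥ x) ≤ θ b}.indicator fun _ => (1 : ℝ)) ∧
      (∀ x, 0 ≤ {x : n → ℝ | ∀ b ∈ B, x ⬝ᵥ (Qb b *ᵥ x) ≤ θ b}.indicator (fun _ => (1 : ℝ)) x) ∧
      (∀ x, {x : n → ℝ | ∀ b ∈ B, x ⬝ᵥ (Qb b *ᵥ x) ≤ θ b}.indicator (fun _ => (1 : ℝ)) (-x) =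
        {x : n → ℝ | ∀ b ∈ B, x ⬝ᵥ (Qb b *ᵥ x) ≤ θ b}.indicator (fun _ => (1 : ℝ)) x) ∧
      ∀ x y, {x : n → ℝ | ∀ b ∈ B, x ⬝ᵥ (Qb b *ᵥ x) ≤ θ b}.indicator (fun _ => (1 : ℝ)) x *
          {x : n → ℝ | ∀ b ∈ B, x ⬝ᵥ (Qb b *ᵥ x) ≤ θ b}.indicator (fun _ => (1 : ℝ)) y ≤
        {x : n → ℝ | ∀ b ∈ B, x ⬝ᵥ (Qb b *ᵥ x) ≤ θ b}.indicator (fun _ => (1 : ℝ)) ((2 : ℝ)⁻¹ • (x + y)) ^ 2 := by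
  set K : Set (n → ℝ) := {x : n → ℝ | ∀ b ∈ B, x ⬝ᵥ (Qb b *ᵥ x) ≤ θ b} with hK
  have hKmeas : MeasurableSet K := by
    have e : K = ⋂ b ∈ B, {x : n → ℝ | x ⬝ᵥ (Qb b *ᵥ x) ≤ θ b} := by
      ext x
      simp only [hK, Set.mem_setOf_eq, Set.mem_iInter]
    rw [e]
    exact Finset.measurableSet_biInter B fun b _ => measurableSet_le (continuous_qf (Qb b)).measurable measurable_const
  have hKs : ∀ x ∈ K, -x ∈ K := fun x hx b hb => by
    simpa only [mulVec_neg, dotProduct_neg, neg_dotProduct, neg_neg] using hx b hb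
  have hKm : ∀ x ∈ K, ∀ y ∈ K, (2 : ℝ)⁻¹ • (x + y) ∈ K := fun x hx y hy b hb =>
    (qf_midpoint_le (hQ b hb) x y).trans (by have := hx b hb; have := hy b hb; linarith)
  exact ⟨measurable_const.indicator hKmeas, indicator_evenLogConcave hKs hKm⟩

omit [Fintype n] [DecidableEq n] in
/-- **SUPPLIER (c): products.**  The class is closed under multiplication (e.g. `χ·e^{−V}`). [folklore] -/
theorem mul_evenLogConcave {F G : (n → ℝ) → ℝ} (hF0 : ∀ x, 0 ≤ F x) (hG0 : ∀ x, 0 ≤ G x) (hFe : ∀ x, F (-x) = F x)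
    (hGe : ∀ x, G (-x) = G x) (hFlc : ∀ x y, F x * F y ≤ F ((2 : ℝ)⁻¹ • (x + y)) ^ 2)
    (hGlc : ∀ x y, G x * G y ≤ G ((2 : ℝ)⁻¹ • (x + y)) ^ 2) :
    (∀ x, 0 ≤ F x * G x) ∧ (∀ x, F (-x) * G (-x) = F x * G x) ∧
      ∀ x y, (F x * G x) * (F y * G y) ≤ (F ((2 : ℝ)⁻¹ • (x + y)) * G ((2 : ℝ)⁻¹ • (x + y))) ^ 2 := by
  refine ⟨fun x => mul_nonneg (hF0 x) (hG0 x), fun x => by rw [hFe, hGe], fun x y => ?_⟩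
  calc F x * G x * (F y * G y) = (F x * F y) * (G x * G y) := by ring
    _ ≤ F ((2 : ℝ)⁻¹ • (x + y)) ^ 2 * G ((2 : ℝ)⁻¹ • (x + y)) ^ 2 :=
        mul_le_mul (hFlc x y) (hGlc x y) (mul_nonneg (hG0 x) (hG0 y)) (sq_nonneg _)
    _ = (F ((2 : ℝ)⁻¹ • (x + y)) * G ((2 : ℝ)⁻¹ • (x + y))) ^ 2 := by ring

/-! ## §2 The four-integral comparison for a general dominated pair `(S, Q)` -/

/-- Change of variables into an `ℝ≥0∞` integral: for `g ≥ 0` with `g ∘ A` a.e.-strongly measurable and `A` invertible,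
`∫ g = |det A| · (∫⁻ y, g(Ay)).toReal`. [folklore] -/
theorem integral_eq_det_mul_toReal (A : Matrix n n ℝ) (hA : A.det ≠ 0) (g : (n → ℝ) → ℝ) (hg0 : ∀ x, 0 ≤ g x)
    (hgm : AEStronglyMeasurable (fun y => g (A *ᵥ y)) volume) :
    ∫ x, g x = |A.det| * (∫⁻ y, ENNReal.ofReal (g (A *ᵥ y))).toReal := by
  have hdet : 0 < |A.det| := abs_pos.2 hA
  have h := integral_comp_mulVec A hA g
  rw [integral_eq_lintegral_of_nonneg_ae (Filter.Eventually.of_forall fun y => hg0 _) hgm] at h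
  rw [h, ← mul_assoc, mul_inv_cancel₀ hdet.ne', one_mul]

/-- **THE FOUR-INTEGRAL COMPARISON.**  Let `S` be positive definite, `Q` positive semidefinite with `Q ≤ δS`, `δ < 1`, and let
`F ≥ 0` be measurable, EVEN and MIDPOINT-LOG-CONCAVE.  Then
  `(∫ F·e^{xᵀQx}e^{−xᵀSx}) · (∫ e^{−xᵀSx}) ≤ (∫ F·e^{−xᵀSx}) · (∫ e^{xᵀQx}e^{−xᵀSx})`:
in `F`'s own normalisation the exponential moment of the sacrificed form is AT MOST the pure Gaussian one.  Proof: simultaneous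
diagonalisation (`exists_simDiag_dominated`) turns the pair into the companion's product form with `aᵢ = 1 − dᵢ ∈ (0, 1]`, and
`AndersonGaussianComparison.lintegral_mul_wide_le` applies to `F ∘ A`. [folklore] -/
theorem integral_mul_wide_mul_le {S Q : Matrix n n ℝ} {δ : ℝ} (hS : S.PosDef) (hQ : Q.PosSemidef)
    (hdom : (δ • S - Q).PosSemidef) (hδ : δ < 1) {F : (n → ℝ) → ℝ} (hF0 : ∀ x, 0 ≤ F x) (hFm : Measurable F)
    (hFe : ∀ x, F (-x) = F x) (hFlc : ∀ x y, F x * F y ≤ F ((2 : ℝ)⁻¹ • (x + y)) ^ 2) :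
    (∫ x, F x * (exp (x ⬝ᵥ (Q *ᵥ x)) * exp (-(x ⬝ᵥ (S *ᵥ x))))) * (∫ x, exp (-(x ⬝ᵥ (S *ᵥ x)))) ≤
      (∫ x, F x * exp (-(x ⬝ᵥ (S *ᵥ x)))) * (∫ x, exp (x ⬝ᵥ (Q *ᵥ x)) * exp (-(x ⬝ᵥ (S *ᵥ x)))) := by
  obtain ⟨A, d, hA, hSA, hQA, hd0, hdδ, -⟩ := exists_simDiag_dominated hS hQ hdom
  have hdet : 0 < |A.det| := abs_pos.2 hA
  have hAm : Measurable fun y : n → ℝ => A *ᵥ y := (continuous_const.matrix_mulVec continuous_id).measurable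
  -- the widened precisions `aᵢ = 1 − dᵢ ∈ (0, 1]`
  set a : n → ℝ := fun i => 1 - d i with ha
  have ha0 : ∀ i, 0 < a i := fun i => by simp only [ha]; linarith [hdδ i]
  have ha1 : ∀ i, a i ≤ 1 := fun i => by simp only [ha]; linarith [hd0 i]
  have hw : ∀ y : n → ℝ, exp (∑ i, d i * y i ^ 2) * exp (-(∑ i, y i ^ 2)) = exp (-∑ i, a i * y i ^ 2) := by
    intro y
    rw [← exp_add]
    congr 1
    rw [← Finset.sum_neg_distrib, ← Finset.sum_neg_distrib, ← Finset.sum_add_distrib]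
    exact Finset.sum_congr rfl fun i _ => by simp only [ha]; ring
  -- the transported factor `G = F ∘ A`
  set G : (n → ℝ) → ℝ≥0∞ := fun y => ENNReal.ofReal (F (A *ᵥ y)) with hG
  have hGm : Measurable G := (hFm.comp hAm).ennreal_ofReal
  have hGe : ∀ y, G (-y) = G y := fun y => by simp only [hG, mulVec_neg, hFe]
  have hGlc : ∀ x y, G x * G y ≤ G ((2 : ℝ)⁻¹ • (x + y)) ^ 2 := fun x y => by
    simp only [hG]
    rw [← ENNReal.ofReal_mul (hF0 _), ← ENNReal.ofReal_pow (hF0 _), mulVec_smul, mulVec_add]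
    exact ENNReal.ofReal_le_ofReal (hFlc _ _)
  have key := lintegral_mul_wide_le a ha0 ha1 hGm hGe hGlc
  -- the four integrals in the diagonalising coordinates
  have hρm : Measurable fun y : n → ℝ => exp (-(∑ i, y i ^ 2)) := by fun_prop
  have hwm : Measurable fun y : n → ℝ => exp (-∑ i, a i * y i ^ 2) := by fun_prop
  have e1 : ∫ x, F x * (exp (x ⬝ᵥ (Q *ᵥ x)) * exp (-(x ⬝ᵥ (S *ᵥ x)))) =
      |A.det| * (∫⁻ y, G y * ENNReal.ofReal (exp (-∑ i, a i * y i ^ 2))).toReal := by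
    rw [integral_eq_det_mul_toReal A hA _ (fun x => mul_nonneg (hF0 x) (mul_nonneg (exp_pos _).le (exp_pos _).le))]
    · congr 2
      refine lintegral_congr fun y => ?_
      rw [hQA, hSA, hw, ENNReal.ofReal_mul (hF0 _)]
    · simp only [hQA, hSA, hw]
      exact ((hFm.comp hAm).mul hwm).aestronglyMeasurable
  have e2 : ∫ x : n → ℝ, exp (-(x ⬝ᵥ (S *ᵥ x))) = |A.det| * (∫⁻ y : n → ℝ, ENNReal.ofReal (exp (-∑ i, y i ^ 2))).toReal := by
    rw [integral_eq_det_mul_toReal A hA _ (fun x => (exp_pos _).le)]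
    · simp only [hSA]
    · simp only [hSA]
      exact hρm.aestronglyMeasurable
  have e3 : ∫ x, F x * exp (-(x ⬝ᵥ (S *ᵥ x))) = |A.det| * (∫⁻ y, G y * ENNReal.ofReal (exp (-∑ i, y i ^ 2))).toReal := by
    rw [integral_eq_det_mul_toReal A hA _ (fun x => mul_nonneg (hF0 x) (exp_pos _).le)]
    · congr 2
      refine lintegral_congr fun y => ?_
      rw [hSA, ENNReal.ofReal_mul (hF0 _)]
    · simp only [hSA]
      exact ((hFm.comp hAm).mul hρm).aestronglyMeasurable
  have e4 : ∫ x : n → ℝ, exp (x ⬝ᵥ (Q *ᵥ x)) * exp (-(x ⬝ᵥ (S *ᵥ x))) =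
      |A.det| * (∫⁻ y : n → ℝ, ENNReal.ofReal (exp (-∑ i, a i * y i ^ 2))).toReal := by
    rw [integral_eq_det_mul_toReal A hA _ (fun x => mul_nonneg (exp_pos _).le (exp_pos _).le)]
    · simp only [hQA, hSA, hw]
    · simp only [hQA, hSA, hw]
      exact hwm.aestronglyMeasurable
  -- finiteness of the two right-hand factors
  have hF_bdd : ∀ y, ‖F (A *ᵥ y)‖ ≤ F 0 := fun y => by
    rw [Real.norm_eq_abs, abs_of_nonneg (hF0 _)]
    exact le_zero_of_evenLogConcave hF0 hFe hFlc _
  have hρint : Integrable (fun y : n → ℝ => exp (-(∑ i, y i ^ 2))) := by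
    refine Integrable.of_integral_ne_zero ?_
    rw [integral_exp_neg_sum_sq]
    exact (Finset.prod_pos fun _ _ => Real.sqrt_pos.2 Real.pi_pos).ne'
  have hwint : Integrable (fun y : n → ℝ => exp (-∑ i, a i * y i ^ 2)) := by
    have h : Integrable (fun y : n → ℝ => exp (∑ i, d i * y i ^ 2) * exp (-(∑ i, y i ^ 2))) := by
      refine Integrable.of_integral_ne_zero ?_
      rw [integral_exp_diag_mul_exp_neg]
      exact (Finset.prod_pos fun i _ => Real.sqrt_pos.2 (div_pos Real.pi_pos (by linarith [hdδ i]))).ne'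
    exact h.congr (Filter.Eventually.of_forall hw)
  have hfin3 : ∫⁻ y, G y * ENNReal.ofReal (exp (-∑ i, y i ^ 2)) ≠ ⊤ := by
    have hint : Integrable (fun y => F (A *ᵥ y) * exp (-(∑ i, y i ^ 2))) :=
      hρint.bdd_mul (hFm.comp hAm).aestronglyMeasurable (Filter.Eventually.of_forall hF_bdd)
    have h := (lintegral_ofReal_ne_top_iff_integrable hint.aestronglyMeasurable
      (Filter.Eventually.of_forall fun y => mul_nonneg (hF0 _) (exp_pos _).le)).2 hint
    refine fun htop => h ?_
    rw [← htop]
    exact lintegral_congr fun y => by rw [hG, ENNReal.ofReal_mul (hF0 _)]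
  have hfin4 : ∫⁻ y : n → ℝ, ENNReal.ofReal (exp (-∑ i, a i * y i ^ 2)) ≠ ⊤ :=
    (lintegral_ofReal_ne_top_iff_integrable hwint.aestronglyMeasurable
      (Filter.Eventually.of_forall fun y => (exp_pos _).le)).2 hwint
  rw [e1, e2, e3, e4]
  calc |A.det| * (∫⁻ y, G y * ENNReal.ofReal (exp (-∑ i, a i * y i ^ 2))).toReal *
        (|A.det| * (∫⁻ y : n → ℝ, ENNReal.ofReal (exp (-∑ i, y i ^ 2))).toReal)
      = |A.det| ^ 2 * ((∫⁻ y, G y * ENNReal.ofReal (exp (-∑ i, a i * y i ^ 2))) *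
          ∫⁻ y : n → ℝ, ENNReal.ofReal (exp (-∑ i, y i ^ 2))).toReal := by
        rw [ENNReal.toReal_mul]; ring
    _ ≤ |A.det| ^ 2 * ((∫⁻ y, G y * ENNReal.ofReal (exp (-∑ i, y i ^ 2))) *
          ∫⁻ y : n → ℝ, ENNReal.ofReal (exp (-∑ i, a i * y i ^ 2))).toReal :=
        mul_le_mul_of_nonneg_left (ENNReal.toReal_mono (ENNReal.mul_ne_top hfin3 hfin4) key) (sq_nonneg _)
    _ = |A.det| * (∫⁻ y, G y * ENNReal.ofReal (exp (-∑ i, y i ^ 2))).toReal *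
        (|A.det| * (∫⁻ y : n → ℝ, ENNReal.ofReal (exp (-∑ i, a i * y i ^ 2))).toReal) := by
        rw [ENNReal.toReal_mul]; ring

/-! ## §3 The domination lemma at the same constant, in `F`'s own normalisation; tail; carrier junction -/

/-- **THE DOMINATION LEMMA WITH AN EVEN LOG-CONCAVE FACTOR — SAME CONSTANT.**  For `S` positive definite, `Q` positive semidefinite,
`Q ≤ δS` (`0 ≤ δ < 1`), `rank Q ≤ r`, and `F ≥ 0` measurable, even, midpoint-log-concave:
`∫ F·e^{xᵀQx}·e^{−xᵀSx} ≤ (√(1−δ))⁻¹ ^ r · ∫ F·e^{−xᵀSx}`.  No large-field-mass hypothesis, no `(1−η)⁻¹`, no dependence on the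
dimension or on the size of `S` (the coupling). [folklore] -/
theorem logConcaveMoment_le {S Q : Matrix n n ℝ} {δ : ℝ} {r : ℕ} (hS : S.PosDef) (hQ : Q.PosSemidef)
    (hdom : (δ • S - Q).PosSemidef) (hδ0 : 0 ≤ δ) (hδ : δ < 1) (hr : Q.rank ≤ r) {F : (n → ℝ) → ℝ} (hF0 : ∀ x, 0 ≤ F x)
    (hFm : Measurable F) (hFe : ∀ x, F (-x) = F x) (hFlc : ∀ x y, F x * F y ≤ F ((2 : ℝ)⁻¹ • (x + y)) ^ 2) :
    ∫ x, F x * (exp (x ⬝ᵥ (Q *ᵥ x)) * exp (-(x ⬝ᵥ (S *ᵥ x)))) ≤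
      (√(1 - δ))⁻¹ ^ r * ∫ x, F x * exp (-(x ⬝ᵥ (S *ᵥ x))) := by
  have h4 := integral_mul_wide_mul_le hS hQ hdom hδ hF0 hFm hFe hFlc
  have hI₀ := integral_exp_neg_qf_pos hS
  have hIF : 0 ≤ ∫ x, F x * exp (-(x ⬝ᵥ (S *ᵥ x))) := integral_nonneg fun x => mul_nonneg (hF0 x) (exp_pos _).le
  have hdomI := integral_exp_qf_le_of_dominated hS hQ hdom hδ0 hδ hr
  refine le_of_mul_le_mul_right (h4.trans ?_) hI₀
  calc (∫ x, F x * exp (-(x ⬝ᵥ (S *ᵥ x)))) * ∫ x, exp (x ⬝ᵥ (Q *ᵥ x)) * exp (-(x ⬝ᵥ (S *ᵥ x)))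
      ≤ (∫ x, F x * exp (-(x ⬝ᵥ (S *ᵥ x)))) * ((√(1 - δ))⁻¹ ^ r * ∫ x, exp (-(x ⬝ᵥ (S *ᵥ x)))) :=
        mul_le_mul_of_nonneg_left hdomI hIF
    _ = (√(1 - δ))⁻¹ ^ r * (∫ x, F x * exp (-(x ⬝ᵥ (S *ᵥ x)))) * ∫ x, exp (-(x ⬝ᵥ (S *ᵥ x))) := by ring

/-- **NORMALISED FORM** (unconditional: if `∫ F e^{−S} = 0` both sides are handled by the `0∕0 = 0` convention): the expectation of
`e^{xᵀQx}` in the non-Gaussian state `∝ F·e^{−xᵀSx}` is at most `(√(1−δ))⁻¹ ^ r`. [folklore] -/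
theorem logConcaveMoment_div_le {S Q : Matrix n n ℝ} {δ : ℝ} {r : ℕ} (hS : S.PosDef) (hQ : Q.PosSemidef)
    (hdom : (δ • S - Q).PosSemidef) (hδ0 : 0 ≤ δ) (hδ : δ < 1) (hr : Q.rank ≤ r) {F : (n → ℝ) → ℝ} (hF0 : ∀ x, 0 ≤ F x)
    (hFm : Measurable F) (hFe : ∀ x, F (-x) = F x) (hFlc : ∀ x y, F x * F y ≤ F ((2 : ℝ)⁻¹ • (x + y)) ^ 2) :
    (∫ x, F x * (exp (x ⬝ᵥ (Q *ᵥ x)) * exp (-(x ⬝ᵥ (S *ᵥ x))))) / (∫ x, F x * exp (-(x ⬝ᵥ (S *ᵥ x)))) ≤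
      (√(1 - δ))⁻¹ ^ r := by
  have h := logConcaveMoment_le hS hQ hdom hδ0 hδ hr hF0 hFm hFe hFlc
  have hIF : 0 ≤ ∫ x, F x * exp (-(x ⬝ᵥ (S *ᵥ x))) := integral_nonneg fun x => mul_nonneg (hF0 x) (exp_pos _).le
  have hc : 0 ≤ (√(1 - δ))⁻¹ ^ r := pow_nonneg (inv_nonneg.2 (Real.sqrt_nonneg _)) r
  rcases hIF.eq_or_lt with h0 | hpos
  · rw [← h0, div_zero]
    exact hc
  · exact (div_le_iff₀ hpos).2 h

/-- **THE LARGE-FIELD TAIL IN `F`'s NORMALISATION** (Chernoff × the lemma): `∫ F·𝟙{θ ≤ xᵀQx}·e^{−xᵀSx} ≤ e^{−θ}·(√(1−δ))⁻¹ ^ r·∫ F·e^{−xᵀSx}`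
— the small factor `e^{−θ}` per extracted threshold, at the Gaussian price, for the non-Gaussian state `∝ F e^{−S}`. [folklore] -/
theorem logConcaveTail_le {S Q : Matrix n n ℝ} {δ : ℝ} {r : ℕ} (hS : S.PosDef) (hQ : Q.PosSemidef)
    (hdom : (δ • S - Q).PosSemidef) (hδ0 : 0 ≤ δ) (hδ : δ < 1) (hr : Q.rank ≤ r) {F : (n → ℝ) → ℝ} (hF0 : ∀ x, 0 ≤ F x)
    (hFm : Measurable F) (hFe : ∀ x, F (-x) = F x) (hFlc : ∀ x y, F x * F y ≤ F ((2 : ℝ)⁻¹ • (x + y)) ^ 2) (θ : ℝ) :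
    ∫ x, F x * (Set.indicator {x | θ ≤ x ⬝ᵥ (Q *ᵥ x)} (fun _ => (1 : ℝ)) x * exp (-(x ⬝ᵥ (S *ᵥ x)))) ≤
      exp (-θ) * (√(1 - δ))⁻¹ ^ r * ∫ x, F x * exp (-(x ⬝ᵥ (S *ᵥ x))) := by
  have hFb : ∀ x, ‖F x‖ ≤ F 0 := fun x => by
    rw [Real.norm_eq_abs, abs_of_nonneg (hF0 _)]; exact le_zero_of_evenLogConcave hF0 hFe hFlc _
  have hint : Integrable (fun x : n → ℝ => F x * (exp (x ⬝ᵥ (Q *ᵥ x)) * exp (-(x ⬝ᵥ (S *ᵥ x))))) :=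
    (integrable_exp_qf_mul_exp_neg_qf hS hQ hdom hδ).bdd_mul hFm.aestronglyMeasurable (Filter.Eventually.of_forall hFb)
  have hχ : ∀ x : n → ℝ, Set.indicator {x | θ ≤ x ⬝ᵥ (Q *ᵥ x)} (fun _ => (1 : ℝ)) x ≤ exp (-θ) * exp (x ⬝ᵥ (Q *ᵥ x)) := by
    intro x
    by_cases hx : x ∈ {x : n → ℝ | θ ≤ x ⬝ᵥ (Q *ᵥ x)}
    · rw [Set.indicator_of_mem hx, ← exp_add]
      exact one_le_exp (by have := hx; simp only [Set.mem_setOf_eq] at this; linarith)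
    · rw [Set.indicator_of_notMem hx]
      exact mul_nonneg (exp_pos _).le (exp_pos _).le
  calc ∫ x, F x * (Set.indicator {x | θ ≤ x ⬝ᵥ (Q *ᵥ x)} (fun _ => (1 : ℝ)) x * exp (-(x ⬝ᵥ (S *ᵥ x))))
      ≤ ∫ x, exp (-θ) * (F x * (exp (x ⬝ᵥ (Q *ᵥ x)) * exp (-(x ⬝ᵥ (S *ᵥ x))))) := by
        refine integral_mono_of_nonneg (Filter.Eventually.of_forall fun x => ?_) (hint.const_mul _)
          (Filter.Eventually.of_forall fun x => ?_)
        · exact mul_nonneg (hF0 x) (mul_nonneg (Set.indicator_nonneg (fun _ _ => zero_le_one) x) (exp_pos _).le)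
        · have h := mul_le_mul_of_nonneg_left (mul_le_mul_of_nonneg_right (hχ x) (exp_pos (-(x ⬝ᵥ (S *ᵥ x)))).le) (hF0 x)
          calc F x * (Set.indicator {x | θ ≤ x ⬝ᵥ (Q *ᵥ x)} (fun _ => (1 : ℝ)) x * exp (-(x ⬝ᵥ (S *ᵥ x))))
              ≤ F x * (exp (-θ) * exp (x ⬝ᵥ (Q *ᵥ x)) * exp (-(x ⬝ᵥ (S *ᵥ x)))) := h
            _ = exp (-θ) * (F x * (exp (x ⬝ᵥ (Q *ᵥ x)) * exp (-(x ⬝ᵥ (S *ᵥ x))))) := by ring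
    _ = exp (-θ) * ∫ x, F x * (exp (x ⬝ᵥ (Q *ᵥ x)) * exp (-(x ⬝ᵥ (S *ᵥ x)))) := integral_const_mul _ _
    _ ≤ exp (-θ) * ((√(1 - δ))⁻¹ ^ r * ∫ x, F x * exp (-(x ⬝ᵥ (S *ᵥ x)))) :=
        mul_le_mul_of_nonneg_left (logConcaveMoment_le hS hQ hdom hδ0 hδ hr hF0 hFm hFe hFlc) (exp_pos _).le
    _ = exp (-θ) * (√(1 - δ))⁻¹ ^ r * ∫ x, F x * exp (-(x ⬝ᵥ (S *ᵥ x))) := by ring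

/-- **COUPLING-FREE FORM**: the same bound with the SAME constant for the rescaled pair `βS, βQ`, `β > 0`, and the same `F`. [folklore] -/
theorem logConcaveMoment_le_smul {S Q : Matrix n n ℝ} {δ β : ℝ} {r : ℕ} (hS : S.PosDef) (hQ : Q.PosSemidef)
    (hdom : (δ • S - Q).PosSemidef) (hδ0 : 0 ≤ δ) (hδ : δ < 1) (hr : Q.rank ≤ r) (hβ : 0 < β) {F : (n → ℝ) → ℝ}
    (hF0 : ∀ x, 0 ≤ F x) (hFm : Measurable F) (hFe : ∀ x, F (-x) = F x)
    (hFlc : ∀ x y, F x * F y ≤ F ((2 : ℝ)⁻¹ • (x + y)) ^ 2) :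
    ∫ x, F x * (exp (x ⬝ᵥ ((β • Q) *ᵥ x)) * exp (-(x ⬝ᵥ ((β • S) *ᵥ x)))) ≤
      (√(1 - δ))⁻¹ ^ r * ∫ x, F x * exp (-(x ⬝ᵥ ((β • S) *ᵥ x))) := by
  refine logConcaveMoment_le (hS.smul hβ) (hQ.smul hβ.le) ?_ hδ0 hδ ?_ hF0 hFm hFe hFlc
  · rw [smul_comm, ← smul_sub]
    exact hdom.smul hβ.le
  · have hu : IsUnit (β • (1 : Matrix n n ℝ)).det := by
      rw [det_smul, det_one, mul_one]
      exact isUnit_iff_ne_zero.2 (pow_ne_zero _ hβ.ne')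
    have e : β • Q = (β • (1 : Matrix n n ℝ)) * Q := by rw [Matrix.smul_mul, Matrix.one_mul]
    rw [e, Matrix.rank_mul_eq_right_of_isUnit_det _ _ hu]
    exact hr

/-- **THE NON-GAUSSIAN CARRIER IS BACKGROUND-UNIFORMLY BOUNDED** (the input `hM0`∕`hMb` of the OWNER's
`GaussianDominatedMoment.locCondStability_of_carrier_le` ∕ `CarrierOnSupport.locCondStability_of_carrier_le_on_support`, as his
`gaussianCarrier_le` but for one-step kernels `F_y·e^{−S_y}` with an even log-concave non-Gaussian factor `F_y` in every background `y`):
the carrier `M y = (∫ F_y e^{Q_y} e^{−S_y}) ∕ (∫ F_y e^{−S_y})` satisfies `0 ≤ M y ≤ e^{r·(−log(1−δ)∕2)}`. [folklore] -/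
theorem logConcaveCarrier_le {Y : Type*} (S Q : Y → Matrix n n ℝ) (F : Y → (n → ℝ) → ℝ) {δ : ℝ} {r : ℕ}
    (hS : ∀ y, (S y).PosDef) (hQ : ∀ y, (Q y).PosSemidef) (hdom : ∀ y, (δ • S y - Q y).PosSemidef) (hδ0 : 0 ≤ δ)
    (hδ : δ < 1) (hr : ∀ y, (Q y).rank ≤ r) (hF0 : ∀ y x, 0 ≤ F y x) (hFm : ∀ y, Measurable (F y))
    (hFe : ∀ y x, F y (-x) = F y x) (hFlc : ∀ y x x', F y x * F y x' ≤ F y ((2 : ℝ)⁻¹ • (x + x')) ^ 2) (y : Y) :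
    0 ≤ (∫ x, F y x * (exp (x ⬝ᵥ (Q y *ᵥ x)) * exp (-(x ⬝ᵥ (S y *ᵥ x))))) / (∫ x, F y x * exp (-(x ⬝ᵥ (S y *ᵥ x)))) ∧
      (∫ x, F y x * (exp (x ⬝ᵥ (Q y *ᵥ x)) * exp (-(x ⬝ᵥ (S y *ᵥ x))))) / (∫ x, F y x * exp (-(x ⬝ᵥ (S y *ᵥ x)))) ≤
        exp (r * (-Real.log (1 - δ) / 2)) := by
  refine ⟨div_nonneg (integral_nonneg fun x => ?_) (integral_nonneg fun x => mul_nonneg (hF0 y x) (exp_pos _).le), ?_⟩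
  · exact mul_nonneg (hF0 y x) (mul_nonneg (exp_pos _).le (exp_pos _).le)
  · rw [← inv_sqrt_pow_eq_exp hδ]
    exact logConcaveMoment_div_le (hS y) (hQ y) (hdom y) hδ0 hδ (hr y) (hF0 y) (hFm y) (hFe y) (hFlc y)

/-- **THE SYMMETRIC-CONVEX SMALL-FIELD RESTRICTION COSTS NOTHING.**  With `χ` the indicator of `{x | xᵀQ_b x ≤ θ_b ∀ b ∈ B}` (`Q_b`
positive semidefinite; thresholds ARBITRARY — no smallness, no large-field-mass estimate):
`∫ χ·e^{xᵀQx}·e^{−xᵀSx} ≤ (√(1−δ))⁻¹ ^ r · ∫ χ·e^{−xᵀSx}`.  Compare `GaussianRestrictedMoment.restrictedMoment_le` (general `0 ≤ F ≤ 1`,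
price `(1−η)⁻¹` under `∫(1−F)e^{−S} ≤ η∫e^{−S}`). [folklore] -/
theorem symmConvexRestrictedMoment_le {ι : Type*} (B : Finset ι) (Qb : ι → Matrix n n ℝ) (θ : ι → ℝ)
    (hQb : ∀ b ∈ B, (Qb b).PosSemidef) {S Q : Matrix n n ℝ} {δ : ℝ} {r : ℕ} (hS : S.PosDef) (hQ : Q.PosSemidef)
    (hdom : (δ • S - Q).PosSemidef) (hδ0 : 0 ≤ δ) (hδ : δ < 1) (hr : Q.rank ≤ r) :
    ∫ x, {x : n → ℝ | ∀ b ∈ B, x ⬝ᵥ (Qb b *ᵥ x) ≤ θ b}.indicator (fun _ => (1 : ℝ)) x *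
        (exp (x ⬝ᵥ (Q *ᵥ x)) * exp (-(x ⬝ᵥ (S *ᵥ x)))) ≤
      (√(1 - δ))⁻¹ ^ r * ∫ x, {x : n → ℝ | ∀ b ∈ B, x ⬝ᵥ (Qb b *ᵥ x) ≤ θ b}.indicator (fun _ => (1 : ℝ)) x *
        exp (-(x ⬝ᵥ (S *ᵥ x))) := by
  obtain ⟨hm, h0, he, hlc⟩ := indicator_qfBall_evenLogConcave B Qb θ hQb
  exact logConcaveMoment_le hS hQ hdom hδ0 hδ hr h0 hm he hlc

end Summit.QuantumFields.BalabanUV.T4Continuum.NE7b.LogConcaveDominatedMoment
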